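import Mathlib
import Literature.RingTheory.CohomologyAnnihilator.Basic
import Summits.ResolutionOfSingularities.ResolutionOfSingularities.Theorems.HomologicalConductorPersistenceHyperplaneLevelDrop
import HarnessLib

/-!
# LEVEL DROP along a polynomial extension, LOCAL form: `caⁿ⁺¹(B[x]_𝔪)` evaluates into `caⁿ(B)`

Route `ResolutionOfSingularities/HomologicalConductor`, chain W4.4b: rung S-2 `PersistenceSurface` (stmt-ResolutionOfSingularities-19970,
stub C1 `SaturationFourSurfaceResidual₄` at product-type NON-NORMAL stages `T₀ = (B × line)_𝔪`, which are LOCAL rings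
`tower A 0 = loc O A`) and the `(V × line)_Q` tables of the all-dimension crux `Persistence` (stmt-ResolutionOfSingularities-16484).
[OURS · folklore homological algebra over LANDED tree lemmas; AI-written, weaker than expert review; NOT a statement of the manuscript
under study (Hironaka 2017) and no statement of that manuscript is used.]  DEF-FREE: no new `def`, no conjecture, no named fact.

The sibling file `…PersistenceHyperplaneLevelDrop` (p829183) proves `c ∈ caⁿ⁺¹(R) ⇒ ε c ∈ caⁿ(A)` for `R` free over `A` on the
powers of `x` and an augmentation `ε` killing `x`.  The stages of the route are LOCALISATIONS `L = S⁻¹R`; this file adds: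

* `smul_ext_eq_zero_of_isLocalization` — for a localisation `L` of `R` and `L`-modules `M, N`: if `algebraMap R L c` kills
  `Extⁿ_L(M, N)` then `c` kills `Extⁿ_R(M, N)` (`L ⊗_R M ≅ M` because `M` is already an `L`-module, `isLocalizedModule_id` +
  `IsLocalizedModule.isBaseChange`; then the converse flat transfer of the sibling file, `L` being `R`-flat);
* **`lift_mem_cohomologyAnnihilatorOfDegree_of_isLocalization`** — if moreover `ε` inverts `S` (e.g. `A` local with maximal
  ideal `𝔫`, `S` the complement of `(𝔫, x)`: `ε s = s(0) ∉ 𝔫`), so that `ε` extends to `ε_L = IsLocalization.lift : L →+* A`, then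
  `c ∈ caⁿ⁺¹(L) ⇒ ε_L c ∈ caⁿ(A)`: every finitely generated `A`-module is an `L`-module through `ε_L` with `x` acting as zero, on
  which `c` acts as `ε_L c`; localisation step + the sibling file's level drop;
  `lift_mem_cohomologyAnnihilator_of_isLocalization` (unlevelled), `algebraMap_mem_cohomologyAnnihilatorOfDegree_succ_imp`
  (the form `algebraMap A L a ∈ caⁿ⁺¹(L) ⇒ a ∈ caⁿ(A)`, i.e. `caⁿ⁺¹((A[x])_𝔪) ∩ A ⊆ caⁿ(A)`).

So `Sat₄` at a local product-type stage `(B[x])_{(𝔫,x)}` forces `ca⁴((B[x])_{(𝔫,x)}) ∩ B ⊆ ca³(B)`; contrapositively a level-wise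
non-membership `b ∉ ca³(B)` at a curve singularity `B` lifts with exponent one to `b ∉ ca⁴` of the local surface stage `B × line`.

References (mechanism only): H. Cartan, S. Eilenberg, *Homological Algebra* (1956), Ch. VI; S. B. Iyengar, R. Takahashi, IMRN 2016,
§2 and Lemma 2.10 [`IyengarTakahashi2014`].
-/

-- single-problem summit: the doubled namespace component `ResolutionOfSingularities` is forced
set_option linter.dupNamespace false

noncomputable section

namespace Summit.ResolutionOfSingularities.ResolutionOfSingularities.Theorems.HomologicalConductor.PersistenceHyperplaneLevelDropLocal

open CategoryTheory CategoryTheory.Abelian Literature.RingTheory.CohomologyAnnihilator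
open Summit.ResolutionOfSingularities.ResolutionOfSingularities.Theorems.HomologicalConductor.PersistenceExtFlatBaseChange
open Summit.ResolutionOfSingularities.ResolutionOfSingularities.Theorems.HomologicalConductor.PersistenceHyperplaneLevelDrop
open scoped TensorProduct

universe u

/-! ## Localisation does not change `Ext`-annihilation of modules that are already local -/

section Loc

variable {R L : Type u} [CommRing R] [CommRing L] [Algebra R L] (S : Submonoid R) [IsLocalization S L]

include S in
/-- **Localisation step.**  `L = S⁻¹R`, `M`, `N` modules over `L` (with the induced `R`-structures).  If `algebraMap R L c`
kills `Extⁿ_L(M, N)` then `c` kills `Extⁿ_R(M, N)`: `M` is its own localisation, so `L ⊗_R M ≅ M` over `L`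
(`IsLocalizedModule.isBaseChange`), and the converse flat transfer applies (`L` is `R`-flat). [cite: IyengarTakahashi2014, Lemma 2.10] -/
theorem smul_ext_eq_zero_of_isLocalization {M N : Type u} [AddCommGroup M] [Module R M] [Module L M]
    [IsScalarTower R L M] [AddCommGroup N] [Module R N] [Module L N] [IsScalarTower R L N] {n : ℕ} {c : R}
    (hc : ∀ e : Ext.{u} (ModuleCat.of L M) (ModuleCat.of L N) n, algebraMap R L c • e = 0)
    (e : Ext.{u} (ModuleCat.of R M) (ModuleCat.of R N) n) : c • e = 0 := by
  haveI : Module.Flat R L := IsLocalization.flat L S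
  haveI : IsLocalizedModule S (LinearMap.id : M →ₗ[R] M) := isLocalizedModule_id S M L
  let η : L ⊗[R] M ≃ₗ[L] M := (IsLocalizedModule.isBaseChange S L (LinearMap.id : M →ₗ[R] M)).equiv
  have hc' : ∀ e' : Ext.{u} (ModuleCat.of L (L ⊗[R] M)) (ModuleCat.of L N) n, algebraMap R L c • e' = 0 :=
    fun e' => smul_ext_eq_zero_of_iso₁ η.toModuleIso hc e'
  exact smul_ext_eq_zero_of_smul_ext_baseChange_eq_zero' hc' e

end Loc

/-! ## The local level drop -/

section LocalDrop

variable {A R L : Type u} [CommRing A] [CommRing R] [CommRing L] [Algebra A R] [Algebra R L] [Algebra A L]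
  [IsScalarTower A R L] (x : R) (b : Module.Basis ℕ A R) (hb : ∀ n : ℕ, b n = x ^ n) (ε : R →ₐ[A] A) (hε : ε x = 0)
  (S : Submonoid R) [IsLocalization S L] (hS : ∀ s : S, IsUnit (ε.toRingHom s))

include hb hε hS in
/-- **`c ∈ caⁿ⁺¹(S⁻¹R) ⇒ ε_L c ∈ caⁿ(A)`** for `R` free over `A` on the powers of `x`, an augmentation `ε : R →ₐ[A] A` killing `x`
and inverting `S`, and `ε_L = IsLocalization.lift : L = S⁻¹R →+* A` its extension.  A finitely generated `A`-module is an `L`-module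
through `ε_L` (hence an `R`-module through `ε`, with `x` acting as zero), finitely generated over `L`, on which `c` acts as
`ε_L c`; the localisation step brings the annihilation down to `R`, and the sibling file's level drop down to `A`. [folklore] -/
theorem lift_mem_cohomologyAnnihilatorOfDegree_of_isLocalization {n : ℕ} {c : L}
    (hc : c ∈ cohomologyAnnihilatorOfDegree L (n + 1)) :
    IsLocalization.lift (M := S) (g := ε.toRingHom) hS c ∈ cohomologyAnnihilatorOfDegree A n := by
  set εL : L →+* A := IsLocalization.lift (M := S) (g := ε.toRingHom) hS with hεL
  have hεL_alg : ∀ r : R, εL (algebraMap R L r) = ε r := fun r => by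
    rw [hεL, IsLocalization.lift_eq]; rfl
  have hεL_A : ∀ a : A, εL (algebraMap A L a) = a := fun a => by
    rw [IsScalarTower.algebraMap_apply A R L, hεL_alg, AlgHom.commutes, Algebra.algebraMap_self_apply]
  rw [mem_cohomologyAnnihilatorOfDegree_iff]
  intro i hi M N hM hN e
  -- the `L`- and `R`-structures through `εL` and `ε = εL ∘ algebraMap`
  letI instLM : Module L M := Module.compHom M εL
  letI instLN : Module L N := Module.compHom N εL
  letI instRM : Module R M := Module.compHom M ε.toRingHom
  letI instRN : Module R N := Module.compHom N ε.toRingHom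
  have hLM : ∀ (q : L) (m : M), q • m = εL q • m := fun _ _ => rfl
  have hLN : ∀ (q : L) (m : N), q • m = εL q • m := fun _ _ => rfl
  have hRM : ∀ (p : R) (m : M), p • m = ε p • m := fun _ _ => rfl
  have hRN : ∀ (p : R) (m : N), p • m = ε p • m := fun _ _ => rfl
  haveI : IsScalarTower R L M := ⟨fun p q m => by
    rw [hLM, hLM, hRM, Algebra.smul_def, map_mul, hεL_alg, mul_smul]⟩
  haveI : IsScalarTower R L N := ⟨fun p q m => by
    rw [hLN, hLN, hRN, Algebra.smul_def, map_mul, hεL_alg, mul_smul]⟩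
  haveI : IsScalarTower A R M := ⟨fun a p m => by rw [hRM, hRM, map_smul, smul_assoc]⟩
  haveI : IsScalarTower A R N := ⟨fun a p m => by rw [hRN, hRN, map_smul, smul_assoc]⟩
  haveI : IsScalarTower A L M := ⟨fun a q m => by
    rw [hLM, hLM, Algebra.smul_def, map_mul, hεL_A, mul_smul]⟩
  haveI : IsScalarTower A L N := ⟨fun a q m => by
    rw [hLN, hLN, Algebra.smul_def, map_mul, hεL_A, mul_smul]⟩
  haveI : Module.Finite A M := hM
  haveI : Module.Finite A N := hN
  haveI : Module.Finite L M := Module.Finite.of_restrictScalars_finite A L M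
  haveI : Module.Finite L N := Module.Finite.of_restrictScalars_finite A L N
  have hxM : ∀ m : M, x • m = 0 := fun m => by rw [hRM, hε, zero_smul]
  have hxN : ∀ m : N, x • m = 0 := fun m => by rw [hRN, hε, zero_smul]
  -- `c` acts on `Ext_L(M, N)` as `algebraMap A L (εL c)`: the difference kills `M`
  have hker : ∀ m : M, (c - algebraMap A L (εL c)) • m = 0 := fun m => by
    rw [hLM, map_sub, hεL_A, sub_self, zero_smul]
  have hcL : ∀ e' : Ext.{u} (ModuleCat.of L M) (ModuleCat.of L N) (i + 1),
      algebraMap R L (algebraMap A R (εL c)) • e' = 0 := by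
    intro e'
    have h1 : c • e' = 0 :=
      (mem_cohomologyAnnihilatorOfDegree_iff.mp hc) (i + 1) (by omega) (ModuleCat.of L M) (ModuleCat.of L N)
        inferInstance inferInstance e'
    have h2 : (c - algebraMap A L (εL c)) • e' = 0 :=
      smul_ext_eq_zero_of_smul_eq_zero₁ (Y := ModuleCat.of L M) hker e'
    rw [sub_smul, h1, zero_sub, neg_eq_zero, IsScalarTower.algebraMap_apply A R L] at h2
    exact h2
  have hcR : ∀ e' : Ext.{u} (ModuleCat.of R M) (ModuleCat.of R N) (i + 1), algebraMap A R (εL c) • e' = 0 :=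
    fun e' => smul_ext_eq_zero_of_isLocalization S hcL e'
  exact smul_ext_eq_zero_of_smul_ext_succ_eq_zero x b hb (M := M) hxM (N := N) hxN hcR e

include hb hε hS in
/-- Unlevelled: `c ∈ ca(S⁻¹R) ⇒ ε_L c ∈ ca(A)`. [folklore] -/
theorem lift_mem_cohomologyAnnihilator_of_isLocalization {c : L} (hc : c ∈ cohomologyAnnihilator L) :
    IsLocalization.lift (M := S) (g := ε.toRingHom) hS c ∈ cohomologyAnnihilator A := by
  obtain ⟨n, hn⟩ := mem_cohomologyAnnihilator_iff.mp hc
  exact mem_cohomologyAnnihilator_iff.mpr ⟨n, lift_mem_cohomologyAnnihilatorOfDegree_of_isLocalization x b hb ε hε S hS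
    (cohomologyAnnihilatorOfDegree_mono (Nat.le_succ n) hn)⟩

include hb hε hS in
/-- **`caⁿ⁺¹(S⁻¹(A[x])) ∩ A ⊆ caⁿ(A)`**: if `algebraMap A L a ∈ caⁿ⁺¹(L)` then `a ∈ caⁿ(A)` (as `ε_L (algebraMap a) = a`).
Contrapositively `a ∉ caⁿ(A) ⇒ algebraMap A L a ∉ caⁿ⁺¹(L)` — the exponent-one lifting of level-wise non-membership from `A` to the
LOCAL stage `(A × line)_𝔪`. [folklore] -/
theorem algebraMap_mem_cohomologyAnnihilatorOfDegree_succ_imp {n : ℕ} {a : A}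
    (ha : algebraMap A L a ∈ cohomologyAnnihilatorOfDegree L (n + 1)) : a ∈ cohomologyAnnihilatorOfDegree A n := by
  have h := lift_mem_cohomologyAnnihilatorOfDegree_of_isLocalization x b hb ε hε S hS ha
  rwa [IsScalarTower.algebraMap_apply A R L, IsLocalization.lift_eq, AlgHom.toRingHom_eq_coe, AlgHom.coe_toRingHom,
    AlgHom.commutes, Algebra.algebraMap_self_apply] at h

end LocalDrop

end Summit.ResolutionOfSingularities.ResolutionOfSingularities.Theorems.HomologicalConductor.PersistenceHyperplaneLevelDropLocal

end
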